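/-
Copyright: lit-balaban cell, Phase-2 proof seat p09 (gen 7).  Statement-level skeleton of a published paper; no proof claims beyond what
the kernel checks below.
-/
import Literature.MathematicalPhysics.QuantumFieldTheory.BalabanImbrieJaffe1984to88.BIJ88Eq541Base0
import Literature.MathematicalPhysics.QuantumFieldTheory.BalabanImbrieJaffe1984to88.BIJ85Eq431DeltaKBridge
import Literature.MathematicalPhysics.QuantumFieldTheory.BalabanImbrieJaffe1984to88.BIJ85Prop522Rescaling

/-!
# `BalabanImbrieJaffe1984to88.BIJ85Eq454PhaseLowerBound` — T. Bałaban, J. Imbrie, A. Jaffe, *Renormalization of the Higgs model: minimizers,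
propagators and the stability of mean field theory*, Commun. Math. Phys. **97** (1985) 299–329 [BalabanImbrieJaffe1985], (4.5.3)–(4.5.4)
p. 312–313 and Sect. 7.2–7.3 p. 326: **the smoothing operator `𝒟_k∂^*Q^{e*}_k` of the background field (4.5.4) is NOT bounded uniformly in `k`
from unit-lattice plaquette functions (sup norm) to η-lattice bond functions (sup norm)** — on the tori of the series its operator of record
satisfies `max_b |(𝒟_k∂^*Q^{e*}_kg)_b| ≥ (L^k/8)·max|g|` for a suitable `g` as soon as `L^{k(4−d)} ≥ 4c₀(d)` — so that the located
hypothesis «`|(𝒟_k∂^*Q^{e*}_kg)_b| ≤ K_D·max|g|`, `K_D` uniform in `k`», through which the cell had planned to close the (7.3.1) ⇒ (7.3.2)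
composition for the ACTUAL background (seat p33's `BIJ85Claim73Background.ActIdx.hO`, GAPS G-C1-05 ADDENDUM 2: *"WHAT REMAINS … τ =
e_k‖𝒟_k∂^*Q^{e*}_kf^{(k)}‖_∞ ≤ K𝓅(e_k)·e_k"*), admits NO such constant (`not_exists_uniform_KD`, `d = 2, 3`), and p33's small-coupling
field `hsmall` then confines the composed theorem to couplings `e_k ≤ 16/(πL^k)` (`ek_le_of_hsmall`).  A NEGATIVE RESULT ABOUT AN UNPRINTED
INTERMEDIATE HYPOTHESIS OF THE CELL; nothing printed is contradicted (HONEST SCOPE below)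

statement-level skeleton of published theorems with citation tags; proofs where landed; nothing here is a claim about the Yang–Mills mass gap

PDF held: `paper:balaban1985-cmp97-bij-higgs-minimizers` (journal page = PDF page + 298); read this session as images: p. 312 [PDF 14] ((4.4.2)–
(4.4.4), (4.5.1)–(4.5.3)), p. 313 [PDF 15] ((4.5.4)), p. 326 [PDF 28] ((7.2.4), the `𝒟_k` remark, (7.3.1)–(7.3.2)) — renders
`HOME/lit-balaban-r15/pages/1985-cmp97-bij-higgs-minimizers-p014/p015/p028-x2.png`; [BalabanImbrieJaffe1988] CMP 114 p. 262 [PDF 6] ((2.20)–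
(2.23)) — render `…/1988-cmp114-bij-abelian-higgs-effective-action-p006-x2.png`.

THE PRINTED TEXT (verbatim).  p. 312: *"(Q^{s*}_kv)_b = 1 if b is strictly contained in a k-block (both endpoints belong to the block); v_c if
the η-lattice bond b belongs to the corridor of bonds connecting the two blocks B^k(c₋) and B^k(c₊). Here c is a unit lattice bond. (4.5.3)"*;
p. 313: *"Now we define (u_k)_b = (Q^{s*}_kv)_b exp[−ie_kη(𝒟_k∂^*Q^{e*}_kf^{(k)})_b]. (4.5.4) This field configuration u_k is the minimal
configuration for the approximate action, up to a gauge transformation."*; p. 326: *"The operators 𝒟_k have the same properties as the operators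
G_k in [6I], Proposition 1.2, with exponential decay but singularities on the diagonal. These properties follow from (4.4.4) and the above
estimates on H_k, C^{(k)}. … let us assume that for the unit lattice field v, |v(∂p) − 1| ≤ e_k𝓅(e_k), (7.3.1) … ⟨φ, Δ_k(u_k)φ⟩ ≥ γΣ|u_k(b)φ(b₊)
− φ(b₋)|² − Me_k^{2−α}Σ|φ(x)|². (7.3.2)"*; p. 305: *"(Q^{e*}f)(p) = L²f(p′), if p ∈ B^e(p′), 0, otherwise. (2.22)"*; [BalabanImbrieJaffe1988]
p. 262: *"Another important kernel is the one generating the gauge transformation: (Q^{s*}_k − 𝒟_k∂^*Q^{e*}_k∂)A = H_kA + ∂C_kA. (2.20)"*.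

CITATION HEADER (lean-in-tree rule).  Part of the lit-balaban TYPED SKELETON (HOME `run/shared/lean/pub/lit-balaban/`), Phase-2 proof seat
p09 GEN 7 (unit `lit-balaban-p09`; gens 1–6: `BIJ85AxialPropagator411` … `BIJ85Ineq723TorusDirichlet`, 24 files), free target G.5-34(d),
TAKING line HOME/STATUS.md 2026-08-21T18:55Z; rows of `HOME/SKELETON.md` concerned: **C1.Eq7.3.1-7.3.2** (the residual link named by the owner r15
in ROWS-C1 v1.49 and by GAPS G-C1-05 ADDENDUM 2), **C1.Eq7.2.4** (the p. 326 `𝒟_k` remark), **C1.Eq4.5.4**; owner r15, referee ref-5.  Decls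
used BY NAME, nothing restated: p31 `BIJ88Eq541Base0.TkF/HkF/CkF/eq220_plain` (= p08's torus (2.20) `BIJ88Eq220Torus.eq220_torus` on plain
carriers), p11 `BIJ85Prop522Torus.HkE/HaxE/DkE/curlOp_comp_HaxE`, p30 `BIJ85Eq531Inputs.QsstarIter/QestarIter/curl_QsstarIter`,
`BIJ85Sigma421Torus.QesOp/toU`, p31 `BIJ85CurlQsstar.torusEdgeCells/mem_edgeB_blockSite_iff`, r15 `BIJ85CellAverages.Cells.Qstar_of_mem`,
p09 `BIJ85AxialPropagator411.curlOp/toE/V411`, `BIJ85UnitPropagator433.deltaOp/inner_deltaOp`, `BIJ85Eq431DeltaKBridge.deltaOp_kernel_decay`,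
p30 `BIJ85Prop521Proof.Hop_eq_HaxOp`, p27 `BIJ85SigmaTorusScaling.curlOp_eq_smul/QesOp_eq_smul`, r18 `BIJ85Prop522Rescaling.dkE_eq_smul_dkE_one`.

WHAT IS PROVED (0 `sorry`, standard axioms; standing range `k ≤ m + K` of `Setup`, `2 ≤ d`; `η = P.eta k = L^{−k}`).
* §1 Stokes at one plaquette (`curl_one_apply`, `exists_bond_of_le_abs_curl`: a circulation `≥ 4m` forces a bond value `≥ m`).
* §2 **where the pull-back's curvature sits** (`exists_edge_plaquette`): every unit plaquette `p′` has an η-plaquette `p₀` (an edge plaquette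
  of (2.21)–(2.22), iterated) with `(Q^{e*}_kg)(p₀) = L^{2k}g(p′)` for EVERY `g` — by (4.5.3) the holonomy `v(∂p′)` of `Q^{s*}_kv` sits entirely
  on such plaquettes (`∂Q^{s*}_k = Q^{e*}_k∂`).
* §3 **the curl of (2.20)** (`curl_TkF_curl`): `∂₁(T_k∂₁A)(p) = (Q^{e*}_k∂_{η}A)(p) − ∂₁(H_kA)(p)`, `T_k = TkF` (any weight `w > 0`), `H_k` the Landau
  minimizer; and `T_k` does not depend on the weight (`TkF_eq_smul`, `TkF_indep_w`).
* §4 **the minimizer's curvature at one plaquette is small**: `w·c²·Σ_p(∂₁H_kδ_{b₀})(p)² = Δ_k(b₀, b₀)` (`energy_HkE_single_eq`, (4.3.1) + (5.2.8))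
  `≤ c₀(d)` at `w = η^d`, `c = η⁻¹` (`sum_sq_curl_HkE_single_le`, from the Δ_k kernel bound of `BIJ85Eq431DeltaKBridge`): `Σ_p(∂₁H_kδ_{b₀})(p)² ≤
  c₀(L^k)^d/(L^k)²`; `|∂₁δ_{b₀}| ≤ 1` (`abs_curl_single_le`), `(∂_cδ_{b₀})(p′₀) = c` (`curl_single_self`).
* §5 **`exists_large_bond`**: ∃ `c₀ = c₀(d) > 0`: on every torus, every `k ≤ m + K`, every `w > 0`: ∃ `g` (`= ∂₁δ_{b₀}`, `|g| ≤ 1`) ∃ `b`: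
  `|(T_kg)_b| ≥ (L^k − (c₀(L^k)^d/(L^k)²)^{1/2})/4`.
* §6 consequences: `KD_ge`; `KD_ge_eighth` (`4c₀(L^k)^d ≤ (L^k)⁴ ⇒ K_D ≥ L^k/8`; automatic for `k ≥ k₀(c₀, L)` when `d ≤ 3` (private `exists_level`));
  **`not_exists_uniform_KD`** (`d = 2, 3`, any positive weights: no `K_D` serves all levels of all tori); **`ek_le_of_hsmall`** (p33's `hsmall` +
  `K_D ≥ L^k/8` ⇒ `e_k ≤ 16/(πL^k)`).
HONEST SCOPE.  (i) What is refuted is the cell's located reading «sup-norm bound of the COMPOSITE `𝒟_k∂^*Q^{e*}_k` on unit-lattice plaquette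
functions, uniform in k» (an unprinted intermediate hypothesis, p33's `hO`); the printed p. 326 sentence about `𝒟_k` ([6I] Prop. 1.2-type kernel
bounds WITH singularities on the diagonal) is neither used nor contradicted — `Q^{e*}_k` alone has sup norm `L^{2k}` (§2).  (ii) Mechanism =
print's: the phase of (4.5.4) must carry the flux `e_kf^{(k)}(p′)` away from the edge plaquettes where (4.5.3) concentrates it (p. 313 *"minimal
configuration … up to a gauge transformation"*; [BalabanImbrieJaffe1988] (2.20)), so it is `O(e_k)` — not `O(e_kη)` — on their bonds; the
smallness usable for (7.3.2) is that of the CURVATURE of `u_k` (seat p11's member `BIJ85Ineq732General`, GAPS G-C1-05 ADDENDUM 3), whose linear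
germ is §3: the η-curvature of `u_k` for `v = e^{ie_kA}` is `e_kη·∂₁(H_kA)` up to a pure gauge — what remains for the row is a sup bound of the
minimizer's curvature by the data's curvature ((7.2.2)'s `∇H_k` member), recorded in GAPS G-C1-05 ADDENDUM 4.  (iii) Torus model of the series
(`Setup`, periodic b.c.), `U(1)`, real fields; constants `c₀(d)` existential (the pub-balaban cell's).  (iv) No `def`, no `def … : Prop`, no
named fact (D-0026); theorems only.  Unit `lit-balaban-p09` (literature-prover-lit-balaban-p09-g7-0), 2026-08-21.
-/

open scoped BigOperators RealInnerProductSpace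

namespace Literature.MathematicalPhysics.QuantumFieldTheory.BalabanImbrieJaffe1984to88.BIJ85Eq454PhaseLowerBound

open Literature.MathematicalPhysics.QuantumFieldTheory.Balaban1983to89
open LatticeFieldCalculus (curl grad curl_grad supDist)
open BIJ85AxialPropagator411 (BondSpace toE curlOp V411)
open BIJ85Prop521Torus (CoarseSpace toEj QsE)
open BIJ85Prop521Proof (HaxOp Hop_eq_HaxOp)
open BIJ85UnitPropagator433 (deltaOp inner_deltaOp)
open BIJ85Prop522Torus (HaxE HkE DkE curlOp_comp_HaxE)
open BIJ85Sigma421Torus (UnitPlaqSpace toU QesOp)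
open BIJ85Eq531Inputs (QsstarIter QestarIter QestarIter_succ curl_QsstarIter)
open BIJ85CurlQsstar (torusEdgeCells mem_edgeB_blockSite_iff)
open BIJ85Eq431DeltaKBridge (deltaOp_kernel_decay eta_pow_pos Lpow_ne_zero)
open BIJ88Eq541Base0 (TkF HkF CkF eq220_plain HkF_apply)
open BIJ85SigmaTorusScaling (curlOp_eq_smul QesOp_eq_smul)
open BIJ85Prop522Rescaling (dkE_eq_smul_dkE_one)

noncomputable section

variable {P : Params}

/-! ## §1  Stokes at one plaquette: a large circulation forces a large bond value -/

/-- kernel: the circulation of a bond function around a plaquette, `(∂X)(p) = X(b₁) + X(b₂) − X(b₃) − X(b₄)` (factor `1`).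
[cite: BalabanImbrieJaffe1985, (4.1.1) p.309] -/
theorem curl_one_apply {j : ℕ} (X : PBond P j → ℝ) (p : Balaban1983to89.Plaq P j) :
    curl 1 X p = X ⟨p.src, p.μ⟩ + X ⟨p.src.shift p.μ, p.ν⟩ - X ⟨p.src.shift p.ν, p.μ⟩ - X ⟨p.src, p.ν⟩ := by
  simp only [curl, one_smul]

/-- kernel (Stokes at one plaquette): if the circulation of `X` around `p` is at least `4m` in absolute value, one of the four bonds of `p`
carries `|X_b| ≥ m`. [cite: BalabanImbrieJaffe1985, (4.5.4) p.313] -/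
theorem exists_bond_of_le_abs_curl {j : ℕ} (X : PBond P j → ℝ) (p : Balaban1983to89.Plaq P j) {m : ℝ} (h : 4 * m ≤ |curl 1 X p|) :
    ∃ b : PBond P j, m ≤ |X b| := by
  by_contra! hcon
  have h1 := hcon ⟨p.src, p.μ⟩
  have h2 := hcon ⟨p.src.shift p.μ, p.ν⟩
  have h3 := hcon ⟨p.src.shift p.ν, p.μ⟩
  have h4 := hcon ⟨p.src, p.ν⟩
  rw [curl_one_apply] at h
  have t1 := abs_sub (X ⟨p.src, p.μ⟩ + X ⟨p.src.shift p.μ, p.ν⟩ - X ⟨p.src.shift p.ν, p.μ⟩) (X ⟨p.src, p.ν⟩)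
  have t2 := abs_sub (X ⟨p.src, p.μ⟩ + X ⟨p.src.shift p.μ, p.ν⟩) (X ⟨p.src.shift p.ν, p.μ⟩)
  have t3 := abs_add_le (X ⟨p.src, p.μ⟩) (X ⟨p.src.shift p.μ, p.ν⟩)
  linarith

/-- kernel: a lattice step changes the site (the tori have at least two sites per direction). [folklore] -/
private theorem shift_ne_self {k : ℕ} (y : Balaban1983to89.Site P k) (μ : Fin P.d) : y.shift μ ≠ y := by
  intro h
  have h1 := congrFun h μ
  simp only [Balaban1983to89.Site.shift, Function.update_self] at h1
  exact one_ne_zero (add_eq_left.1 h1)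

/-! ## §2  The edge plaquettes of `Q^{e*}_k`: where the pull-back's curvature sits -/

/-- **The edge plaquettes of (2.21)–(2.22) iterated** (p. 305: *"(Q^{e*}f)(p) = L²f(p′), if p ∈ B^e(p′), 0, otherwise. (2.22)"*): for every
unit-lattice plaquette `p′ ∈ T^{(k)}` there is an η-plaquette `p` (the top-corner plaquette of the nested blocks) at which the k-fold edge
pull-back evaluates EVERY plaquette function as `(Q^{e*}_kg)(p) = L^{2k}g(p′)` (standing range `k ≤ m + K`, `2 ≤ d`).
[cite: BalabanImbrieJaffe1985, (2.22) p.305] -/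
theorem exists_edge_plaquette (hd : 2 ≤ P.d) : ∀ (k : ℕ), k ≤ P.m + P.K → ∀ p' : Balaban1983to89.Plaq P k,
    ∃ p : Balaban1983to89.Plaq P 0, ∀ g : Balaban1983to89.Plaq P k → ℝ, QestarIter hd k g p = ((P.L : ℝ) ^ 2) ^ k * g p'
  | 0, _, p' => ⟨p', fun g => by simp⟩
  | k + 1, hk, p' => by
    have hL := P.L_pos
    let r : Fin P.d → Fin P.L := fun _ => ⟨P.L - 1, by omega⟩
    let p₁ : Balaban1983to89.Plaq P k := ⟨Site.blockSite p'.src r, p'.μ, p'.ν, p'.hμν⟩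
    have hmem : p₁ ∈ (torusEdgeCells P k hd).B p' := by
      refine (mem_edgeB_blockSite_iff hk hd p' p'.src r p'.hμν).2 ⟨rfl, ?_, ?_⟩
      · show P.L - 1 + 1 = P.L
        omega
      · show P.L - 1 + 1 = P.L
        omega
    obtain ⟨p, hp⟩ := exists_edge_plaquette hd k (by omega) p₁
    refine ⟨p, fun g => ?_⟩
    rw [QestarIter_succ, hp, BIJ85CellAverages.Cells.Qstar_of_mem _ g hmem]
    show ((P.L : ℝ) ^ 2) ^ k * ((P.L : ℝ) ^ 2 * g p') = ((P.L : ℝ) ^ 2) ^ (k + 1) * g p'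
    ring

/-! ## §3  The curl of (2.20): `∂(𝒟_k∂^*Q^{e*}_k)∂A = Q^{e*}_k∂A − ∂H_kA` on the tori -/

/-- kernel: `η = L^{−k}` of `Setup` satisfies `ηL^k = 1`. [folklore] -/
private theorem eta_mul_Lpow (P : Params) (k : ℕ) : P.eta k * (P.L : ℝ) ^ k = 1 := by
  unfold Params.eta
  rw [inv_pow, inv_mul_cancel₀ (Lpow_ne_zero P k)]

/-- kernel: `η⁻¹ = L^k`. [folklore] -/
private theorem eta_inv (P : Params) (k : ℕ) : (P.eta k)⁻¹ = (P.L : ℝ) ^ k := by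
  unfold Params.eta
  rw [inv_pow, inv_inv]

/-- **The curl of the gauge-generating identity (2.20) of [BalabanImbrieJaffe1988] / of (I.5.3.1) + (I.5.2.6)**: on the torus,
for every unit-lattice bond function `A`, `∂(T_k∂A) = Q^{e*}_k(∂A) − ∂(H_kA)` plaquette by plaquette, `T_k = 𝒟_k∂^*Q^{e*}_k` the smoothing
operator of (4.5.4) (p31's `TkF` = p11/p30's `DkE ∘ (curlOp)† ∘ QesOp`), `H_k` the Landau minimizer (4.4.2) — from p31's plain-carrier
(2.20) `eq220_plain` (`Q^{s*}_kA − T_k∂A = H_kA + ∂^ηC_kA`), `∂Q^{s*}_k = Q^{e*}_k∂` (`curl_QsstarIter`) and `∂∂^η = 0` (`curl_grad`); here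
`∂` on `T^{(0)}` has factor `1` and on `T^{(k)}` factor `L^{−k} = η` (any weight `w > 0`, standing range).
[cite: BalabanImbrieJaffe1985, (4.5.4) p.313] -/
theorem curl_TkF_curl (hd : 2 ≤ P.d) {k : ℕ} (hk : k ≤ P.m + P.K) {w : ℝ} (hw : 0 < w) (A : PBond P k → ℝ) (p : Balaban1983to89.Plaq P 0) :
    curl 1 (TkF P hd w (P.eta k) k (curl 1 A)) p =
      QestarIter hd k (curl ((P.L : ℝ) ^ k)⁻¹ A) p - curl 1 (HkF P w (P.eta k) k A) p := by
  have hη := eta_mul_Lpow P k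
  have e : ∀ b, TkF P hd w (P.eta k) k (curl 1 A) b =
      QsstarIter k A b - HkF P w (P.eta k) k A b - grad (P.eta k)⁻¹ (CkF P hd w (P.eta k) k A) b := by
    intro b
    have := eq220_plain hd hk hη hw A b
    linarith
  have hQ : curl 1 (QsstarIter k A) p = QestarIter hd k (curl ((P.L : ℝ) ^ k)⁻¹ A) p := by
    have h := curl_QsstarIter hd hk (((P.L : ℝ) ^ k)⁻¹) A
    rw [mul_inv_cancel₀ (Lpow_ne_zero P k)] at h
    exact congrFun h p
  have hG : curl 1 (grad (P.eta k)⁻¹ (CkF P hd w (P.eta k) k A)) p = 0 := curl_grad _ _ _ _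
  rw [curl_one_apply, e, e, e, e]
  rw [curl_one_apply] at hQ hG
  rw [curl_one_apply (HkF P w (P.eta k) k A)]
  linarith

/-! ## §4  The minimizer's curvature at one plaquette is small: the Δ_k diagonal -/

/-- kernel: components of p09's weighted curl, `(curlOp w c v)(p) = √w·(∂_c v)(p)`. [cite: BalabanImbrieJaffe1985, (4.1.1) p.309] -/
theorem curlOp_apply_eq (w c : ℝ) (v : BondSpace P) (p : Balaban1983to89.Plaq P 0) :
    curlOp (P := P) w c v p = Real.sqrt w * curl c ((toE P).symm v) p := rfl

/-- kernel: `∂_c = c·∂_1`. [cite: Balaban1984PropagatorsI, (1.2) p.18] -/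
theorem curl_eq_mul_curl_one {j : ℕ} (c : ℝ) (X : PBond P j → ℝ) (p : Balaban1983to89.Plaq P j) : curl c X p = c * curl 1 X p := by
  simp only [curl, smul_eq_mul, one_mul]

/-- kernel: `‖√w·∂_c v‖² = w·c²·Σ_p (∂_1 v)(p)²` for the Euclidean norm of p09's `curlOp`. [cite: BalabanImbrieJaffe1985, (4.1.1) p.309] -/
theorem norm_sq_curlOp_eq {w : ℝ} (hw : 0 ≤ w) (c : ℝ) (v : BondSpace P) :
    ‖curlOp (P := P) w c v‖ ^ 2 = w * c ^ 2 * ∑ p : Balaban1983to89.Plaq P 0, (curl 1 ((toE P).symm v) p) ^ 2 := by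
  rw [EuclideanSpace.norm_sq_eq, Finset.mul_sum]
  refine Finset.sum_congr rfl fun p _ => ?_
  rw [Real.norm_eq_abs, sq_abs, curlOp_apply_eq, curl_eq_mul_curl_one c, mul_pow, mul_pow, Real.sq_sqrt hw]
  ring

/-- kernel: the unit plaquette function `∂δ_{b₀}` (the curl of the indicator of one unit bond) is bounded by `1` — the four bonds of a
plaquette are pairwise distinct. [cite: BalabanImbrieJaffe1985, (4.2.4) p.310] -/
theorem abs_curl_single_le {j : ℕ} [DecidableEq (PBond P j)] (b₀ : PBond P j) (q : Balaban1983to89.Plaq P j) :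
    |curl 1 (Pi.single b₀ (1 : ℝ)) q| ≤ 1 := by
  rw [curl_one_apply]
  have d12 : (⟨q.src, q.μ⟩ : PBond P j) ≠ ⟨q.src.shift q.μ, q.ν⟩ := fun h => ne_of_lt q.hμν (PBond.mk.inj h).2
  have d13 : (⟨q.src, q.μ⟩ : PBond P j) ≠ ⟨q.src.shift q.ν, q.μ⟩ := fun h => shift_ne_self q.src q.ν (PBond.mk.inj h).1.symm
  have d14 : (⟨q.src, q.μ⟩ : PBond P j) ≠ ⟨q.src, q.ν⟩ := fun h => ne_of_lt q.hμν (PBond.mk.inj h).2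
  have d23 : (⟨q.src.shift q.μ, q.ν⟩ : PBond P j) ≠ ⟨q.src.shift q.ν, q.μ⟩ :=
    fun h => (ne_of_lt q.hμν).symm (PBond.mk.inj h).2
  have d24 : (⟨q.src.shift q.μ, q.ν⟩ : PBond P j) ≠ ⟨q.src, q.ν⟩ := fun h => shift_ne_self q.src q.μ (PBond.mk.inj h).1
  have d34 : (⟨q.src.shift q.ν, q.μ⟩ : PBond P j) ≠ ⟨q.src, q.ν⟩ := fun h => ne_of_lt q.hμν (PBond.mk.inj h).2
  by_cases h1 : (⟨q.src, q.μ⟩ : PBond P j) = b₀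
  · subst h1
    rw [Pi.single_eq_same, Pi.single_eq_of_ne d12.symm, Pi.single_eq_of_ne d13.symm, Pi.single_eq_of_ne d14.symm]
    norm_num
  rw [Pi.single_eq_of_ne h1]
  by_cases h2 : (⟨q.src.shift q.μ, q.ν⟩ : PBond P j) = b₀
  · subst h2
    rw [Pi.single_eq_same, Pi.single_eq_of_ne d23.symm, Pi.single_eq_of_ne d24.symm]
    norm_num
  rw [Pi.single_eq_of_ne h2]
  by_cases h3 : (⟨q.src.shift q.ν, q.μ⟩ : PBond P j) = b₀
  · subst h3
    rw [Pi.single_eq_same, Pi.single_eq_of_ne d34.symm]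
    norm_num
  rw [Pi.single_eq_of_ne h3]
  by_cases h4 : (⟨q.src, q.ν⟩ : PBond P j) = b₀
  · subst h4
    rw [Pi.single_eq_same]
    norm_num
  rw [Pi.single_eq_of_ne h4]
  norm_num

/-- kernel: at the plaquette `p′₀ = ⟨x, μ, ν⟩` spanned by the bond `b₀ = ⟨x, μ⟩`, `(∂_c δ_{b₀})(p′₀) = c`.
[cite: BalabanImbrieJaffe1985, (4.2.4) p.310] -/
theorem curl_single_self {j : ℕ} [DecidableEq (PBond P j)] (c : ℝ) (x : Balaban1983to89.Site P j) {μ ν : Fin P.d} (hμν : μ < ν) :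
    curl c (Pi.single (⟨x, μ⟩ : PBond P j) (1 : ℝ)) ⟨x, μ, ν, hμν⟩ = c := by
  rw [curl_eq_mul_curl_one, curl_one_apply]
  have d2 : (⟨x.shift μ, ν⟩ : PBond P j) ≠ ⟨x, μ⟩ := fun h => (ne_of_lt hμν).symm (PBond.mk.inj h).2
  have d3 : (⟨x.shift ν, μ⟩ : PBond P j) ≠ ⟨x, μ⟩ := fun h => shift_ne_self x ν (PBond.mk.inj h).1
  have d4 : (⟨x, ν⟩ : PBond P j) ≠ ⟨x, μ⟩ := fun h => (ne_of_lt hμν).symm (PBond.mk.inj h).2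
  simp only
  rw [Pi.single_eq_same, Pi.single_eq_of_ne d2, Pi.single_eq_of_ne d3, Pi.single_eq_of_ne d4]
  ring

/-- **The curl energy of the minimizer of a single unit bond is the Δ_k diagonal**: `w·c²·Σ_p (∂_1H_kδ_{b₀})(p)² = Δ_k(b₀, b₀)`, with
`Δ_k = (∂H_{k,Ax})^*(∂H_{k,Ax})` of (4.3.1) (p09 gen 2's `deltaOp`) and `∂H_k = ∂H_{k,Ax}` ((5.2.8), `curlOp_comp_HaxE`) — `H_k` the Landau
minimizer (4.4.2) as p11's `HkE` (`k ≤ m + K`, `c ≠ 0`, `w > 0`). [cite: BalabanImbrieJaffe1985, (4.3.1) p.311] -/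
theorem energy_HkE_single_eq {k : ℕ} [DecidableEq (PBond P k)] (hk : k ≤ P.m + P.K) {w : ℝ} (hw : 0 < w) {c : ℝ} (hc : c ≠ 0)
    (b₀ : PBond P k) :
    w * c ^ 2 * ∑ p : Balaban1983to89.Plaq P 0, (curl 1 ((toE P).symm (HkE P w c k (EuclideanSpace.single b₀ 1))) p) ^ 2 =
      deltaOp (V411 P k) (curlOp (P := P) w c) (QsE P k) (EuclideanSpace.single b₀ 1) b₀ := by
  have h1 : deltaOp (V411 P k) (curlOp (P := P) w c) (QsE P k) (EuclideanSpace.single b₀ 1) b₀ =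
      ⟪EuclideanSpace.single b₀ (1 : ℝ), deltaOp (V411 P k) (curlOp (P := P) w c) (QsE P k) (EuclideanSpace.single b₀ 1)⟫ := by
    rw [EuclideanSpace.inner_single_left]
    simp
  have h2 : curlOp (P := P) w c (BIJ85UnitPropagator433.Hop (V411 P k) (curlOp (P := P) w c) (QsE P k)
      (EuclideanSpace.single b₀ 1)) = curlOp (P := P) w c (HkE P w c k (EuclideanSpace.single b₀ 1)) := by
    rw [Hop_eq_HaxOp]
    exact LinearMap.congr_fun (curlOp_comp_HaxE hk hc hw) (EuclideanSpace.single b₀ 1)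
  rw [h1, inner_deltaOp, h2, norm_sq_curlOp_eq hw.le]

/-- **The minimizer's curvature at any single η-plaquette is small**: for the Landau minimizer of the indicator of one unit bond, in
the physical normalisation `w = η^d`, `c = η⁻¹ = L^k` of the tori, `Σ_p (∂_1H_kδ_{b₀})(p)² ≤ c₀(d)·(L^k)^d/(L^k)²` — because this energy is
`Δ_k(b₀, b₀)/(η^dη⁻²)` and THE KERNEL OF Δ_k IS BOUNDED ON THE DIAGONAL by a constant depending on `d` only (p09 gen 6's
`BIJ85Eq431DeltaKBridge.deltaOp_kernel_decay`, from [6I] (1.19)/(1.65) and [6II]); in natural units each plaquette of the minimizer carries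
curvature `O(η²)`. [cite: BalabanImbrieJaffe1985, (4.3.1) p.311] -/
theorem sum_sq_curl_HkE_single_le (d : ℕ) (hd1 : 1 ≤ d) :
    ∃ c₀ : ℝ, 0 < c₀ ∧ ∀ (P : Params), P.d = d → ∀ (k : ℕ) (_ : DecidableEq (PBond P k)), k ≤ P.m + P.K →
      ∀ b₀ : PBond P k,
        ∑ p : Balaban1983to89.Plaq P 0,
            (curl 1 ((toE P).symm (HkE P (P.eta k ^ P.d) ((P.L : ℝ) ^ k) k (EuclideanSpace.single b₀ 1))) p) ^ 2 ≤
          c₀ * ((P.L : ℝ) ^ k) ^ P.d / ((P.L : ℝ) ^ k) ^ 2 := by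
  obtain ⟨c₀, δ₀, hc₀, hδ₀, H⟩ := deltaOp_kernel_decay d hd1
  refine ⟨c₀, hc₀, fun P hP k _ hk b₀ => ?_⟩
  have hN : (0 : ℝ) < (P.L : ℝ) ^ k := pow_pos (Nat.cast_pos.2 P.L_pos) k
  have hw : 0 < P.eta k ^ P.d := eta_pow_pos P k P.d
  have hΔ : deltaOp (V411 P k) (curlOp (P := P) (P.eta k ^ P.d) ((P.L : ℝ) ^ k)) (QsE P k)
      (EuclideanSpace.single b₀ 1) b₀ ≤ c₀ := by
    have h := H P hP k inferInstance hk b₀ b₀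
    have hexp : Real.exp (-(δ₀ * (supDist b₀.src b₀.src : ℝ))) ≤ 1 := by
      rw [Real.exp_le_one_iff]
      have : (0 : ℝ) ≤ (supDist b₀.src b₀.src : ℝ) := Nat.cast_nonneg _
      nlinarith
    calc _ ≤ |deltaOp (V411 P k) (curlOp (P := P) (P.eta k ^ P.d) ((P.L : ℝ) ^ k)) (QsE P k)
          (EuclideanSpace.single b₀ 1) b₀| := le_abs_self _
      _ ≤ c₀ * Real.exp (-(δ₀ * (supDist b₀.src b₀.src : ℝ))) := h
      _ ≤ c₀ * 1 := mul_le_mul_of_nonneg_left hexp hc₀.le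
      _ = c₀ := mul_one _
  have hE := energy_HkE_single_eq hk hw (Lpow_ne_zero P k) b₀
  have heta : P.eta k = ((P.L : ℝ) ^ k)⁻¹ := by
    unfold Params.eta
    rw [inv_pow]
  rw [heta] at hE hΔ
  rw [heta, le_div_iff₀ (pow_pos hN 2)]
  have hwc : (0 : ℝ) < (((P.L : ℝ) ^ k)⁻¹) ^ P.d * ((P.L : ℝ) ^ k) ^ 2 := by positivity
  -- `Σ ≤ c₀/(w c²)` and `1/(w c²) = N^d/N²`
  have key : (((P.L : ℝ) ^ k)⁻¹) ^ P.d * ((P.L : ℝ) ^ k) ^ 2 *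
      ∑ p : Balaban1983to89.Plaq P 0, (curl 1 ((toE P).symm (HkE P ((((P.L : ℝ) ^ k)⁻¹) ^ P.d) ((P.L : ℝ) ^ k) k
        (EuclideanSpace.single b₀ 1))) p) ^ 2 ≤ c₀ := by rw [hE]; exact hΔ
  have hid : (((P.L : ℝ) ^ k)⁻¹) ^ P.d * ((P.L : ℝ) ^ k) ^ P.d = 1 := by
    rw [← mul_pow, inv_mul_cancel₀ hN.ne', one_pow]
  have hNd : (0 : ℝ) ≤ ((P.L : ℝ) ^ k) ^ P.d := by positivity
  have e1 : (∑ p : Balaban1983to89.Plaq P 0, (curl 1 ((toE P).symm (HkE P ((((P.L : ℝ) ^ k)⁻¹) ^ P.d) ((P.L : ℝ) ^ k) k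
        (EuclideanSpace.single b₀ 1))) p) ^ 2) * ((P.L : ℝ) ^ k) ^ 2 =
      ((((P.L : ℝ) ^ k)⁻¹) ^ P.d * ((P.L : ℝ) ^ k) ^ 2 *
        ∑ p : Balaban1983to89.Plaq P 0, (curl 1 ((toE P).symm (HkE P ((((P.L : ℝ) ^ k)⁻¹) ^ P.d) ((P.L : ℝ) ^ k) k
          (EuclideanSpace.single b₀ 1))) p) ^ 2) * ((P.L : ℝ) ^ k) ^ P.d := by
    calc (∑ p : Balaban1983to89.Plaq P 0, (curl 1 ((toE P).symm (HkE P ((((P.L : ℝ) ^ k)⁻¹) ^ P.d) ((P.L : ℝ) ^ k) k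
          (EuclideanSpace.single b₀ 1))) p) ^ 2) * ((P.L : ℝ) ^ k) ^ 2
        = ((((P.L : ℝ) ^ k)⁻¹) ^ P.d * ((P.L : ℝ) ^ k) ^ P.d) *
          ((∑ p : Balaban1983to89.Plaq P 0, (curl 1 ((toE P).symm (HkE P ((((P.L : ℝ) ^ k)⁻¹) ^ P.d) ((P.L : ℝ) ^ k) k
            (EuclideanSpace.single b₀ 1))) p) ^ 2) * ((P.L : ℝ) ^ k) ^ 2) := by rw [hid, one_mul]
      _ = _ := by ring
  rw [e1]
  exact mul_le_mul_of_nonneg_right key hNd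

/-- **The smoothing operator does not depend on the weight of the Euclidean carriers**: `T_k = 𝒟_k∂^*Q^{e*}_k` read on plain carriers
(p31's `TkF P hd w η k`) is the same map for every `w > 0` — `𝒟_k` is homogeneous of degree `−1` in `w·c²` (r18's `dkE_eq_smul_dkE_one`),
`∂^* = (√w·c·∂_1)^*` and `Q^{e*}_k` carries `√w` (p27's `curlOp_eq_smul`, `QesOp_eq_smul`), so `T_k = η·(𝒟_k∂^*Q^{e*}_k at w = c = 1)`;
`η ≠ 0`, `k ≤ m + K + 1`. [cite: BalabanImbrieJaffe1985, (4.5.4) p.313] -/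
theorem TkF_eq_smul (hd : 2 ≤ P.d) {k : ℕ} (hk : k ≤ P.m + P.K + 1) {η : ℝ} (hη : η ≠ 0) {w : ℝ} (hw : 0 < w) :
    TkF P hd w η k = η • ((toE P).symm.toLinearMap ∘ₗ
      (DkE P 1 1 k ∘ₗ LinearMap.adjoint (curlOp (P := P) 1 1) ∘ₗ QesOp (P := P) hd 1 k) ∘ₗ (toU P k).toLinearMap) := by
  have hs : Real.sqrt w ^ 2 = w := Real.sq_sqrt hw.le
  have hsq : Real.sqrt w ≠ 0 := (Real.sqrt_pos.2 hw).ne'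
  unfold TkF
  rw [dkE_eq_smul_dkE_one hk hw (inv_ne_zero hη), curlOp_eq_smul w η⁻¹, map_smulₛₗ LinearMap.adjoint, QesOp_eq_smul hd w k]
  simp only [LinearMap.smul_comp, LinearMap.comp_smul, smul_smul, starRingEnd_apply, star_trivial]
  congr 1
  field_simp
  rw [hs]

/-- … hence **`T_k` at weight `w` = `T_k` at weight `w′`** for all `w, w′ > 0` (`η ≠ 0`, `k ≤ m + K + 1`).
[cite: BalabanImbrieJaffe1985, (4.5.4) p.313] -/
theorem TkF_indep_w (hd : 2 ≤ P.d) {k : ℕ} (hk : k ≤ P.m + P.K + 1) {η : ℝ} (hη : η ≠ 0) {w w' : ℝ} (hw : 0 < w)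
    (hw' : 0 < w') : TkF P hd w η k = TkF P hd w' η k := by
  rw [TkF_eq_smul hd hk hη hw, TkF_eq_smul hd hk hη hw']

/-! ## §5  The lower bound: the smoothing operator of (4.5.4) is NOT uniformly bounded in the sup norm -/

/-- **LOWER BOUND FOR THE SMOOTHING OPERATOR `𝒟_k∂^*Q^{e*}_k` OF (4.5.4)** (p. 313: *"(u_k)_b = (Q^{s*}_kv)_b exp[−ie_kη(𝒟_k∂^*Q^{e*}_kf^{(k)})_b].
(4.5.4) This field configuration u_k is the minimal configuration for the approximate action, up to a gauge transformation"*).  There is a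
constant `c₀ = c₀(d) > 0` such that on EVERY torus of `Setup` of dimension `d` and at EVERY level `k ≤ m + K`, for the operator of record
`T_k = 𝒟_k∂^*Q^{e*}_k` (p31's `BIJ88Eq541Base0.TkF` = p11/p30's `DkE ∘ (curlOp η^d η⁻¹)† ∘ QesOp` on plain carriers, `η = L^{−k}`) there are a
unit-lattice plaquette function `g` with `|g| ≤ 1` (namely `g = ∂δ_{b₀}`) and an η-bond `b` with
**`|(T_kg)_b| ≥ (L^k − (c₀(L^k)^d/(L^k)²)^{1/2})/4`**.  MECHANISM (printed objects only): by (4.5.3) the curvature of the pull-back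
`Q^{s*}_k` is CONCENTRATED on the edge plaquettes of (2.21) (`exists_edge_plaquette`: `(Q^{e*}_k∂δ_{b₀})(p₀) = L^{2k}·L^{−k}`), the curl of (2.20)
(`curl_TkF_curl`) reads `∂(T_k∂δ_{b₀})(p₀) = L^k − (∂H_kδ_{b₀})(p₀)`, the minimizer's curvature there is at most `(c₀(L^k)^d/(L^k)²)^{1/2}`
(`sum_sq_curl_HkE_single_le`), and a circulation `≥ 4m` forces a bond value `≥ m` (`exists_bond_of_le_abs_curl`).
[cite: BalabanImbrieJaffe1985, (4.5.4) p.313] -/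
theorem exists_large_bond (d : ℕ) (hd1 : 1 ≤ d) :
    ∃ c₀ : ℝ, 0 < c₀ ∧ ∀ (P : Params) (_ : P.d = d) (hd : 2 ≤ P.d) (k : ℕ), k ≤ P.m + P.K → ∀ {w : ℝ}, 0 < w →
      ∃ g : Balaban1983to89.Plaq P k → ℝ, (∀ q, |g q| ≤ 1) ∧ ∃ b : PBond P 0,
        ((P.L : ℝ) ^ k - Real.sqrt (c₀ * ((P.L : ℝ) ^ k) ^ P.d / ((P.L : ℝ) ^ k) ^ 2)) / 4 ≤
          |TkF P hd w (P.eta k) k g b| := by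
  obtain ⟨c₀, hc₀, H⟩ := sum_sq_curl_HkE_single_le d hd1
  refine ⟨c₀, hc₀, fun P hP hd k hk w' hw' => ?_⟩
  classical
  have hN : (0 : ℝ) < (P.L : ℝ) ^ k := pow_pos (Nat.cast_pos.2 P.L_pos) k
  have hw : 0 < P.eta k ^ P.d := eta_pow_pos P k P.d
  have hη0 : P.eta k ≠ 0 := by
    have h := eta_pow_pos P k 1
    rw [pow_one] at h
    exact h.ne'
  rw [TkF_indep_w hd (by omega) hη0 hw' hw]
  -- the unit bond `b₀ = ⟨x₀, e₀⟩`, the plaquette `p′₀ = ⟨x₀, e₀, e₁⟩` it spans, `A = δ_{b₀}`, `g = ∂A`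
  let μ₀ : Fin P.d := ⟨0, by omega⟩
  let ν₀ : Fin P.d := ⟨1, by omega⟩
  have hμν : μ₀ < ν₀ := Fin.mk_lt_mk.2 zero_lt_one
  let x₀ : Balaban1983to89.Site P k := default
  let b₀ : PBond P k := ⟨x₀, μ₀⟩
  let p'₀ : Balaban1983to89.Plaq P k := ⟨x₀, μ₀, ν₀, hμν⟩
  let A : PBond P k → ℝ := Pi.single b₀ 1
  refine ⟨curl 1 A, fun q => abs_curl_single_le b₀ q, ?_⟩
  -- an edge plaquette `p₀` of `p′₀`
  obtain ⟨p₀, hp₀⟩ := exists_edge_plaquette hd k hk p'₀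
  -- the curl of (2.20) at `p₀`
  have hid := curl_TkF_curl hd hk hw A p₀
  have hQ : QestarIter hd k (curl ((P.L : ℝ) ^ k)⁻¹ A) p₀ = (P.L : ℝ) ^ k := by
    rw [hp₀, curl_single_self]
    have e : ((P.L : ℝ) ^ 2) ^ k = ((P.L : ℝ) ^ k) ^ 2 := by ring
    rw [e, sq, mul_assoc, mul_inv_cancel₀ hN.ne', mul_one]
  -- the minimizer's curvature at `p₀`
  have hH : |curl 1 (HkF P (P.eta k ^ P.d) (P.eta k) k A) p₀| ≤
      Real.sqrt (c₀ * ((P.L : ℝ) ^ k) ^ P.d / ((P.L : ℝ) ^ k) ^ 2) := by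
    have hF : (HkF P (P.eta k ^ P.d) (P.eta k) k A : PBond P 0 → ℝ) =
        (toE P).symm (HkE P (P.eta k ^ P.d) ((P.L : ℝ) ^ k) k (EuclideanSpace.single b₀ 1)) := by
      funext b
      rw [HkF_apply, eta_inv]
      rfl
    rw [hF]
    apply Real.abs_le_sqrt
    refine le_trans ?_ (H P hP k inferInstance hk b₀)
    exact Finset.single_le_sum (f := fun p => (curl 1 ((toE P).symm (HkE P (P.eta k ^ P.d) ((P.L : ℝ) ^ k) k
      (EuclideanSpace.single b₀ 1))) p) ^ 2) (fun p _ => sq_nonneg _) (Finset.mem_univ p₀)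
  -- Stokes at `p₀`
  have hcirc : (P.L : ℝ) ^ k - Real.sqrt (c₀ * ((P.L : ℝ) ^ k) ^ P.d / ((P.L : ℝ) ^ k) ^ 2) ≤
      |curl 1 (TkF P hd (P.eta k ^ P.d) (P.eta k) k (curl 1 A)) p₀| := by
    rw [hid, hQ]
    have t := abs_sub_abs_le_abs_sub ((P.L : ℝ) ^ k) (curl 1 (HkF P (P.eta k ^ P.d) (P.eta k) k A) p₀)
    rw [abs_of_pos hN] at t
    linarith
  exact exists_bond_of_le_abs_curl _ p₀ (by linarith)

/-! ## §6  Consequences: no uniform `K_D`; the small-coupling window of the τ-route -/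

/-- **Any constant `K_D` in the located sup-norm property `|(T_kg)_b| ≤ K_D·max|g|` of the operator of record (the field `hO` of p33's
`BIJ85Claim73Background.ActIdx`, p. 326: *"The operators 𝒟_k have the same properties as the operators G_k in [6I], Proposition 1.2"*)
satisfies `K_D ≥ (L^k − (c₀(L^k)^d/(L^k)²)^{1/2})/4`**, `c₀ = c₀(d)` as in `exists_large_bond`. [cite: BalabanImbrieJaffe1985, (7.2.4) p.326] -/
theorem KD_ge (d : ℕ) (hd1 : 1 ≤ d) :
    ∃ c₀ : ℝ, 0 < c₀ ∧ ∀ (P : Params) (_ : P.d = d) (hd : 2 ≤ P.d) (k : ℕ), k ≤ P.m + P.K → ∀ {w : ℝ}, 0 < w →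
      ∀ KD : ℝ, (∀ (g : Balaban1983to89.Plaq P k → ℝ) (C : ℝ), (∀ q, |g q| ≤ C) →
        ∀ b, |TkF P hd w (P.eta k) k g b| ≤ KD * C) →
      ((P.L : ℝ) ^ k - Real.sqrt (c₀ * ((P.L : ℝ) ^ k) ^ P.d / ((P.L : ℝ) ^ k) ^ 2)) / 4 ≤ KD := by
  obtain ⟨c₀, hc₀, H⟩ := exists_large_bond d hd1
  refine ⟨c₀, hc₀, fun P hP hd k hk w hw KD hO => ?_⟩
  obtain ⟨g, hg, b, hb⟩ := H P hP hd k hk hw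
  have h := hO g 1 hg b
  linarith

/-- **… in particular `K_D ≥ L^k/8` as soon as `4c₀(L^k)^d ≤ (L^k)⁴`** (for `d ≤ 3`: for every `k ≥ k₀(d, L)`, see the private `exists_level` and `not_exists_uniform_KD`).
[cite: BalabanImbrieJaffe1985, (7.2.4) p.326] -/
theorem KD_ge_eighth (d : ℕ) (hd1 : 1 ≤ d) :
    ∃ c₀ : ℝ, 0 < c₀ ∧ ∀ (P : Params) (_ : P.d = d) (hd : 2 ≤ P.d) (k : ℕ), k ≤ P.m + P.K →
      4 * c₀ * ((P.L : ℝ) ^ k) ^ P.d ≤ ((P.L : ℝ) ^ k) ^ 4 → ∀ {w : ℝ}, 0 < w → ∀ KD : ℝ,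
      (∀ (g : Balaban1983to89.Plaq P k → ℝ) (C : ℝ), (∀ q, |g q| ≤ C) →
        ∀ b, |TkF P hd w (P.eta k) k g b| ≤ KD * C) →
      (P.L : ℝ) ^ k / 8 ≤ KD := by
  obtain ⟨c₀, hc₀, H⟩ := KD_ge d hd1
  refine ⟨c₀, hc₀, fun P hP hd k hk h4 w hw KD hO => ?_⟩
  have hN : (0 : ℝ) < (P.L : ℝ) ^ k := pow_pos (Nat.cast_pos.2 P.L_pos) k
  have h := H P hP hd k hk hw KD hO
  have hs : Real.sqrt (c₀ * ((P.L : ℝ) ^ k) ^ P.d / ((P.L : ℝ) ^ k) ^ 2) ≤ (P.L : ℝ) ^ k / 2 := by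
    rw [Real.sqrt_le_iff]
    refine ⟨by positivity, ?_⟩
    rw [div_le_iff₀ (pow_pos hN 2)]
    have e : ((P.L : ℝ) ^ k / 2) ^ 2 * ((P.L : ℝ) ^ k) ^ 2 = ((P.L : ℝ) ^ k) ^ 4 / 4 := by ring
    rw [e]
    linarith
  linarith

/-- kernel: for `d ≤ 3` the proviso `4c₀(L^k)^d ≤ (L^k)⁴` holds at every level `k ≥ k₀(c₀, L)` (`L ≥ 2`). [folklore] -/
private theorem exists_level (P : Params) (hd3 : P.d ≤ 3) (c₀ : ℝ) :
    ∃ k₀ : ℕ, ∀ k, k₀ ≤ k → 4 * c₀ * ((P.L : ℝ) ^ k) ^ P.d ≤ ((P.L : ℝ) ^ k) ^ 4 := by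
  have hL1 : (1 : ℝ) < (P.L : ℝ) := by exact_mod_cast P.hL.2
  obtain ⟨k₀, hk₀⟩ := pow_unbounded_of_one_lt (4 * c₀) hL1
  refine ⟨k₀, fun k hk => ?_⟩
  have hN1 : (1 : ℝ) ≤ (P.L : ℝ) ^ k := one_le_pow₀ hL1.le
  have hk' : (P.L : ℝ) ^ k₀ ≤ (P.L : ℝ) ^ k := pow_le_pow_right₀ hL1.le hk
  have hNd : (0 : ℝ) ≤ ((P.L : ℝ) ^ k) ^ P.d := by positivity
  have hpow : ((P.L : ℝ) ^ k) ^ P.d * (P.L : ℝ) ^ k ≤ ((P.L : ℝ) ^ k) ^ 4 := by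
    rw [← pow_succ]
    exact pow_le_pow_right₀ hN1 (by omega)
  nlinarith

/-- **NO `K_D` UNIFORM IN `k` EXISTS** (`d = 2, 3`): the located sup-norm hypothesis on `𝒟_k∂^*Q^{e*}_k` with ONE constant for all levels of
all tori of dimension `d` — the input named as «the ℓ^∞ → ℓ^∞ bound of the torus operator of record, uniform in k» for the (7.3.1) ⇒ (7.3.2)
composition — is FALSE for the operator of record.  (The tori `⟨d, L = 3, m = 0, K = k⟩` carry every level `k`.)
[cite: BalabanImbrieJaffe1985, (7.2.4) p.326] -/
theorem not_exists_uniform_KD (d : ℕ) (hd2 : 2 ≤ d) (hd3 : d ≤ 3) (wt : Params → ℕ → ℝ)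
    (hwt : ∀ P k, 0 < wt P k) :
    ¬ ∃ KD : ℝ, ∀ (P : Params) (_ : P.d = d) (hd : 2 ≤ P.d) (k : ℕ), k ≤ P.m + P.K →
      ∀ (g : Balaban1983to89.Plaq P k → ℝ) (C : ℝ), (∀ q, |g q| ≤ C) →
        ∀ b, |TkF P hd (wt P k) (P.eta k) k g b| ≤ KD * C := by
  rintro ⟨KD, hKD⟩
  obtain ⟨c₀, hc₀, H⟩ := KD_ge_eighth d (by omega)
  -- the tori `⟨d, 3, 0, k⟩`
  let P₀ : ℕ → Params := fun k => ⟨d, 3, 0, k, by omega, ⟨⟨1, rfl⟩, by norm_num⟩⟩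
  obtain ⟨k₁, hk₁⟩ := exists_level (P₀ 0) (by simpa using hd3) c₀
  have h3 : (1 : ℝ) < 3 := by norm_num
  obtain ⟨k₂, hk₂⟩ := pow_unbounded_of_one_lt (8 * KD) h3
  obtain ⟨k, hk1, hk2⟩ : ∃ k, k₁ ≤ k ∧ k₂ ≤ k := ⟨max k₁ k₂, le_max_left _ _, le_max_right _ _⟩
  have hk : k ≤ (P₀ k).m + (P₀ k).K := by show k ≤ 0 + k; omega
  have h4 : 4 * c₀ * (((P₀ k).L : ℝ) ^ k) ^ (P₀ k).d ≤ (((P₀ k).L : ℝ) ^ k) ^ 4 := hk₁ k hk1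
  have h := H (P₀ k) rfl (by simpa using hd2) k hk h4 (hwt (P₀ k) k) KD (hKD (P₀ k) rfl (by simpa using hd2) k hk)
  have hge : (3 : ℝ) ^ k₂ ≤ (3 : ℝ) ^ k := pow_le_pow_right₀ h3.le hk2
  have hL : (((P₀ k).L : ℝ)) = 3 := by show ((3 : ℕ) : ℝ) = 3; norm_num
  rw [hL] at h
  have h8 : (3 : ℝ) ^ k ≤ 8 * KD := by linarith
  linarith

/-- **THE SMALL-COUPLING WINDOW OF THE τ-ROUTE**: with p33's fields `hsmall : 36d(2d+1)²((π/2)K_De_k(1 + ln e_k⁻¹)^p)² ≤ 1`, `0 < e_k ≤ 1`,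
`0 ≤ p` (`BIJ85Claim73Background.ActIdx`) and `K_D ≥ L^k/8` (the operator of record, `KD_ge_eighth`), necessarily **`e_k ≤ 16/(πL^k)`** — the
composed (7.3.1) ⇒ (7.3.2) theorem `claim73_actual` instantiated at the ACTUAL smoothing operator covers only couplings `e_k = O(L^{−k})`; the
hypothesis (7.3.1) `|v(∂p) − 1| ≤ e_k𝓅(e_k)` of print places no such restriction. [cite: BalabanImbrieJaffe1985, (7.3.1) p.326] -/
theorem ek_le_of_hsmall {N KD ek p : ℝ} (d : ℕ) (hd1 : 1 ≤ d) (hN : 0 < N) (hKD : N / 8 ≤ KD) (hek : 0 < ek) (hek1 : ek ≤ 1)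
    (hp : 0 ≤ p) (hsmall : 36 * d * (2 * d + 1) ^ 2 * (Real.pi / 2 * KD * ek * (1 + Real.log ek⁻¹) ^ p) ^ 2 ≤ 1) :
    ek ≤ 16 / (Real.pi * N) := by
  have hπ := Real.pi_pos
  have hKDpos : 0 < KD := by linarith
  have hcal : 1 ≤ (1 + Real.log ek⁻¹) ^ p :=
    Real.one_le_rpow (by have := Real.log_nonneg ((one_le_inv₀ hek).2 hek1); linarith) hp
  set t := Real.pi / 2 * KD * ek * (1 + Real.log ek⁻¹) ^ p with ht
  have ht0 : 0 ≤ t := by rw [ht]; positivity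
  have hd' : (1 : ℝ) ≤ 36 * d * (2 * d + 1) ^ 2 := by
    have : (1 : ℝ) ≤ d := by exact_mod_cast hd1
    nlinarith
  have ht1 : t ≤ 1 := by
    have hsq : t ^ 2 ≤ 1 := by nlinarith [sq_nonneg t]
    exact (sq_le_one_iff₀ ht0).1 hsq
  -- `(π/2)·K_D·e_k ≤ t ≤ 1`
  have h1 : Real.pi / 2 * KD * ek ≤ 1 := by
    have : Real.pi / 2 * KD * ek * 1 ≤ t := by rw [ht]; exact mul_le_mul_of_nonneg_left hcal (by positivity)
    linarith
  -- `e_k ≤ 2/(πK_D) ≤ 16/(πN)`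
  rw [le_div_iff₀ (by positivity)]
  have h2 : ek * (Real.pi * KD) ≤ 2 := by nlinarith
  have h3 : ek * (Real.pi * N) ≤ ek * (Real.pi * (8 * KD)) := by
    apply mul_le_mul_of_nonneg_left _ hek.le
    exact mul_le_mul_of_nonneg_left (by linarith) hπ.le
  nlinarith

end

end Literature.MathematicalPhysics.QuantumFieldTheory.BalabanImbrieJaffe1984to88.BIJ85Eq454PhaseLowerBound
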